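import Summits.QuantumFields.YangMills.Theorems.BalabanUVNodesN22JointChartsOfActivityJointHolo
import Summits.QuantumFields.YangMills.Theorems.BalabanUVNodesN22WindowSoftTwoPointAtSlotsNonzeroChartModel

/-!
# BalabanUVNodes ∕ node N22 = NE9 — A6 AT THE ACTIVITY LEVEL FOR THE ANALYTIC ROAD (ROAD 3), part 1∕2: THE REAL U(1) MODEL and its JOINT
# (coupling, field) CHART — a NON-DEGENERATE inhabitant of the three activity-chart binders `hℋ ∕ hMℋ ∕ hfℋ` of
# `…N22JointChartsOfActivityJointHolo` §2 whose (2.13) terms are REAL at real data (the holomorphic road's `hIm`)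

WIDTH SEAT dag-n22-w1 (harness re-seat g5), piece C7 of its own lineage (C1 `…N22WindowedTwoConstants` → C2 `…N22KernelFadingOfStepRateTwoConstants`
→ C3 `…N22WindowedCouplingHoloOfJointHolo` → C4 `…N22WindowedCouplingHoloOfLocalTerms` → C6 `…N22JointChartsOfActivityJointHolo`; C5 = the kernel-level
model inhabitant of C2).  Cell `pub-ymgap`, HUMAN RULING D-0062 (Track A) ∕ D-0149; `--kind proof --supports stmt-QuantumFields-27366 --as helper` (K3⁸
`SpineGivenEndpointR13SepCoPHV`, KEY MAP v2), COUNT-NEUTRAL.  THEOREMS ONLY (0 `def`, 0 `sorry`, standard axioms).  Imports C6 (p631151) and dag-n22-w2 g4's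
`…N22WindowSoftTwoPointAtSlotsNonzeroChartModel` (p610496: the U(1) model on Bałaban's torus bookkeeping, `norm_invCard_mul_sum_le_one`, `norm_readout_le_one`;
through it dag-n22-w1 g3's `PhaseTower.sum_update_mul`) BY NAME.  Nothing re-declared.

WHY.  C6 §2 `jointCharts_of_activityJointCharts` DISPLAYS three activity-level binders — JOINT (young coupling, field) charts `ℋ` of the activities, holomorphic
on `Dt × ball(0, R)` (`hℋ`), with the (2.38) majorant there (`hMℋ`), agreeing at real points with `H(Z; (h|h_m:=t)_{≤k}; emb(exp ρB))` (`hfℋ`) — and C4 §2 adds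
the reality binder `hIm` of the (2.13) terms at real data.  The inhabitants in the tree are DEGENERATE for this road: the termless towers (`H ≡ 0`), the
configuration-constant phase tower (p611030, declared there), and dag-n22-w2's U(1) model p610496 ∕ p613716 — configuration-reading, but with COMPLEX terms
(`e^{iΣ g_i ω^{k+1−i}}`, `e^{iB}`), so `hIm` fails.  THIS FILE types the REAL EDITION of that U(1) model and its joint chart, on which all four binders hold
NON-DEGENERATELY (part 2∕2 `…RealU1ModelFires` fires C6 §2 and C4 §2 on it).  THE REAL U(1) MODEL (`𝔸 = 𝔄 := ℂ`, `V := ℝ`, chart `ρ = (x ↦ ix)`): one term per polymer,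
  `H(Z; g; φ) = A e^{−R d_{k+1}(Z)} · cos(Σ_{i≤k} g_i ω^{k+1−i}) · (1∕N_{k+1}) Σ_{(l,t)} e^{−r∕w_Z(t̃)} · φ.1⟨embIter (k+1) t, l⟩`   (`t̃ = blockIter (k+1) (embIter (k+1) t)`),
read at `emb K k W = (b ↦ ½(W_{b.dir}(t_b) + W_{b.dir}(t_b)⁻¹), 0)` — the SELF-ADJOINT PART of the pulled-back probe holonomy (at `W = e^{iB}`: `cos B_{b.dir}(t_b)`, REAL) —
with dag-n22-w2's site weights `w_X(t) = B₃e^{−δ₀ distCT(cast t, nearT X)}` (= the p. 282 tails), their INJECTIVE complexification `ι_X B = (B_{l,t}·w_X(t))` and model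
spaces; THE JOINT CHART `ℋ(τ, z) = A e^{−R d(Z)} · cos(a + τ·c) · (1∕N) Σ e^{−r∕w_Z(t̃)} cos(z_{l,t̃}∕w_X(t̃))` at phase offset `a = Σ_j (h|h_m:=0)_j ω^{k+1−j}` and slope
`c = ω^{k+1−m}` (`0` if `m > k`).

WHAT (all [folklore]).  §1 REALNESS OF (2.13) FOR REAL ACTIVITIES (generic polymer gas): `polymerLogZ_im_eq_zero_of_real` (NO zero-freeness needed: the ray integrand is
real pointwise — Literature `polymerRayDeriv_im_eq_zero` ∕ `polymerPartitionFunction_im_eq_zero` — and `intervalIntegral.integral_ofReal`),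
`truncatedWeight_im_eq_zero_of_real` (Möbius sum), `locE_im_eq_zero_of_real`, `E_im_eq_zero_of_real_H` (W1's `ClusterStep.E`).  §2 THE MODEL STEP under its display
`hS`: `readout_im_eq_zero`, `norm_H_le_cos_realU1` (the (2.38) value shape WITH its cosine factor on the model spaces, ANY prefix), ★ `H_im_eq_zero_realU1` ∕
`E_im_eq_zero_realU1` (REAL at real prefixes and real `𝐔`), NON-DEGENERACY `H_reads_config_realU1` (`H(Z;g;0) = 0 ∧ ‖H(Z;0;𝟙)‖ > 0`),
`H_update_realU1` (a genuine cosine phase in EVERY young coupling), `exists_update_H_ne_realU1` (two couplings `s₀, s₁` with `H(g|g_i:=s₀) ≠ H(g|g_i:=s₁)` whenever the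
read-out is non-zero).  §3 scalar lemmas (`‖cos ζ‖ ≤ e^{|Im ζ|} ≤ e^{‖ζ‖}`, `‖cos(z∕w)‖ ≤ e^{r∕w}`, `cos((B·w)∕w) = ½(e^{iB} + (e^{iB})⁻¹)`), ★ `sum_histPrefix_update`
(the prefix phase is AFFINE in one updated coupling, slope `c_m ∈ [0,1]` — `slope_mem_Icc`), and THE JOINT CHART: ★ `differentiable_jointChart` (ENTIRE on
`ℂ × (Fin d → Site_{k+1} → ℂ)` — `hℋ` on any set), ★ `norm_jointChart_le` (`≤ A·e^{s}·e^{−R d(Z)}` on `{|Im τ| < s} ×ˢ ball 0 r` for `Z ⊆ X`, `c ∈ [0,1]` — `hMℋ`),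
★ `jointChart_agree` (`= H(Z; g; emb(e^{iB}))` at `(t, ι_X B)` for every prefix with phase `a + t·c` — `hfℋ`).

HONEST FRAMING (binding).  An A6 MODEL WITNESS (abelian toy on Bałaban's torus bookkeeping), count-neutral: it certifies ONLY that the activity-level antecedent of
the analytic road (C6 §2's three chart binders + C4 §2's reality binder) is jointly satisfiable by activities that READ the configuration AND every young coupling,
with an honest (injective) complexification at a non-zero chart.  It is NOT NODE 00's tower, NOT the minimizer reading `U_{k+1}(e^{iB})`, NOT print's chart `θ.ρ8`,
NOT gauge-covariant; N18's kernel step rate ∕ (1.21) existence at this model are NOT claimed (C2 §1 is NOT fired: def-B's ∕ N18's binders); nothing of Bałaban's is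
asserted or constructed ([I] = CMP 109 (1987) p. 263, (1.18)–(1.21), p. 282; [II] = CMP 116 (1988) (2.13)–(2.14) pp. 14–15, Lemma 3 (2.38) p. 20 — TYPES only);
N22 NOT discharged (typed 28∕28 · discharged 5∕27 UNCHANGED — the chair's single count line is the only count); K3⁸ OPEN, NOT claimed, no stub touched; one finite
𝕋⁴ programme at fixed ε — R4 closes the CONDITIONAL rung `BalabanLadder.UV` only; NOTHING about the continuum limit, ℝ⁴, OS axioms, a mass gap or the Clay
problem is proved or claimed by any of this.
-/

noncomputable section

open Filter Topology Set Metric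
open scoped BigOperators

namespace YMDAG.N22.JointHoloLocalTerms.RealU1

open Literature.MathematicalPhysics.QuantumFieldTheory.Balaban1983to89
open Literature.MathematicalPhysics.QuantumFieldTheory.Balaban1983to89.T4Continuum (T4Family)
open Literature.MathematicalPhysics.QuantumFieldTheory.Balaban1983to89.Node00.Sect2 (domCount domSys CPair)
open Literature.MathematicalPhysics.QuantumFieldTheory.Balaban1983to89.Node00.W1 (ClusterTower ClusterStep)
open Literature.MathematicalPhysics.QuantumFieldTheory.Balaban1983to89.Node00.U3OfKernels (histPrefix histPrefix_apply)
open Literature.MathematicalPhysics.QuantumFieldTheory.Balaban1983to89.B13Resummation (locE)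
open Literature.MathematicalPhysics.QuantumFieldTheory.Balaban1983to89.B13FamilySum (coveringFamilies)
open Literature.MathematicalPhysics.QuantumFieldTheory.Balaban1983to89.B14.Eq22Determines (blockIter)
open Literature.MathematicalPhysics.QuantumFieldTheory.Balaban1983to89.B15DeterminingSets (embIter)
open Literature.Probability.LatticeModels (polymerLogZ truncatedWeight polymerRayDeriv polymerPartitionFunction polymerRayDeriv_im_eq_zero
  polymerPartitionFunction_im_eq_zero)
open YMDAG.N22.W1.CouplingRadii.PhaseTower (sum_update_mul)
open YMDAG.N22.WindowSoftTwoPoint.NonzeroChart (norm_invCard_mul_sum_le_one norm_cexp_I_mul_div_le norm_readout_le_one)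

/-! ## §1 REALNESS OF (2.13) FOR REAL ACTIVITIES: the Kotecký–Preiss logarithm, its Möbius transform and the localized term are real -/

section Real

variable {Pol : Type*} [DecidableEq Pol] {inc : Pol → Pol → Prop} [DecidableRel inc]

/-- **For real activities the Kotecký–Preiss logarithm is REAL** — with NO zero-freeness hypothesis: the ray integrand
`Z′(t·w)∕Z(t·w)` is real pointwise (Literature `polymerRayDeriv_im_eq_zero` ∕ `polymerPartitionFunction_im_eq_zero`) and the interval integral of a
real function is real (`intervalIntegral.integral_ofReal`). [folklore] -/
theorem polymerLogZ_im_eq_zero_of_real {w : Pol → ℂ} (hw : ∀ γ, (w γ).im = 0) (B : Finset Pol) : (polymerLogZ inc w B).im = 0 := by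
  set q : ℝ → ℂ := fun t => polymerRayDeriv inc w B t / polymerPartitionFunction inc (fun γ => (t : ℂ) * w γ) B with hqdef
  have him : ∀ t : ℝ, (q t).im = 0 := fun t => by
    have h1 := polymerRayDeriv_im_eq_zero (inc := inc) hw B t
    have h2 := polymerPartitionFunction_im_eq_zero (inc := inc) (w := fun γ => (t : ℂ) * w γ) (fun γ => by simp [hw γ]) B
    simp only [hqdef, Complex.div_im, h1, h2, zero_mul, mul_zero, zero_div, sub_self]
  have hq : ∀ t, q t = (((q t).re : ℝ) : ℂ) := fun t => Complex.ext (by simp) (by rw [Complex.ofReal_im]; exact him t)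
  have hL : polymerLogZ inc w B = ((∫ t in (0 : ℝ)..1, (q t).re : ℝ) : ℂ) := by
    show (∫ t in (0 : ℝ)..1, q t) = _
    rw [← intervalIntegral.integral_ofReal]
    exact intervalIntegral.integral_congr fun t _ => hq t
  rw [hL, Complex.ofReal_im]

/-- **For real activities the truncated functional `Φ^T(C) = Σ_{B ⊆ C} (−1)^{|C∖B|} log Z(B)` is REAL.** [folklore] -/
theorem truncatedWeight_im_eq_zero_of_real {w : Pol → ℂ} (hw : ∀ γ, (w γ).im = 0) (C : Finset Pol) : (truncatedWeight inc w C).im = 0 := by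
  show (∑ B ∈ C.powerset, (-1 : ℂ) ^ (C \ B).card * polymerLogZ inc w B).im = 0
  rw [Complex.im_sum]
  refine Finset.sum_eq_zero fun B _ => ?_
  have h1 : ((-1 : ℂ) ^ (C \ B).card).im = 0 := by
    rw [show ((-1 : ℂ) ^ (C \ B).card) = (((-1 : ℝ) ^ (C \ B).card : ℝ) : ℂ) by push_cast; rfl, Complex.ofReal_im]
  rw [Complex.mul_im, polymerLogZ_im_eq_zero_of_real hw, h1, mul_zero, zero_mul, add_zero]

variable {Dom Cube : Type*} [DecidableEq Dom] [DecidableEq Cube] [Fintype Dom] (ιc : Dom → Dom → Prop) [DecidableRel ιc]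

/-- **For real activities the (2.13) localized term `E(X) = Σ_{C : ∪C = X} Φ^T(C)` is REAL.** [folklore] -/
theorem locE_im_eq_zero_of_real (cubes : Dom → Finset Cube) {w : Dom → ℂ} (hw : ∀ Z, (w Z).im = 0) (X : Finset Cube) :
    (locE ιc cubes w X).im = 0 := by
  show (∑ C ∈ coveringFamilies (Finset.univ : Finset Dom) cubes X, truncatedWeight ιc w C).im = 0
  rw [Complex.im_sum]
  exact Finset.sum_eq_zero fun C _ => truncatedWeight_im_eq_zero_of_real hw C

open Classical in
/-- **W1's (2.13) term `E^{(k+1)}(X; g; φ)` is REAL whenever the step's activities `H(Z; g; φ)` are all real** (`ClusterStep.E_eq_locE`). [folklore] -/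
theorem E_im_eq_zero_of_real_H {P : Params} {𝔸 : Type*} {M k : ℕ} (S : ClusterStep P 𝔸 M k) (g : Fin (k + 1) → ℝ) (φ : CPair P 𝔸)
    (hH : ∀ Z, (S.H g φ Z).im = 0) (X : (domSys P M (k + 1)).Dom) : (S.E g φ X).im = 0 := by
  rw [ClusterStep.E_eq_locE]
  exact locE_im_eq_zero_of_real _ _ hH _

end Real

/-! ## §2 THE REAL U(1) MODEL STEP: activities `H(Z; g; φ) = A e^{−R d(Z)} · cos(Σ g_i ω^{k+1−i}) · avg_{(l,t)} e^{−r∕w_Z(t̃)} φ.1⟨embIter t, l⟩` — the (2.38) value shape, REALITY at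
real data, and NON-DEGENERACY (reads the configuration AND every young coupling) -/

section Step

variable {P : Params} {M k : ℕ} (S : ClusterStep P ℂ M k) (wt : (domSys P M (k + 1)).Dom → Site P (k + 1) → ℝ) {A R ω r : ℝ}
variable (hS : ∀ (g : Fin (k + 1) → ℝ) (φ : CPair P ℂ) (Z : (domSys P M (k + 1)).Dom),
  S.H g φ Z = ((A * Real.exp (-(R * (domSys P M (k + 1)).dj Z)) * Real.cos (∑ i : Fin (k + 1), g i * ω ^ (k + 1 - (i : ℕ))) : ℝ) : ℂ) *
    (((Fintype.card (Fin P.d × Site P (k + 1)) : ℂ))⁻¹ *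
      ∑ lt : Fin P.d × Site P (k + 1), ((Real.exp (-(r / wt Z (blockIter (k + 1) (embIter (k + 1) lt.2)))) : ℝ) : ℂ) *
        φ.1 ⟨embIter (k + 1) lt.2, lt.1⟩))

/-- The normalised read-out `(1∕N) Σ_{(l,t)} e^{−r∕w_Z(t̃)} φ.1⟨t̃, l⟩` is REAL on configurations whose `𝐔`-component is real. [folklore] -/
theorem readout_im_eq_zero (Z : (domSys P M (k + 1)).Dom) (φ : CPair P ℂ) (hφ : ∀ b : PBond P 0, (φ.1 b).im = 0) :
    (((Fintype.card (Fin P.d × Site P (k + 1)) : ℂ))⁻¹ *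
      ∑ lt : Fin P.d × Site P (k + 1), ((Real.exp (-(r / wt Z (blockIter (k + 1) (embIter (k + 1) lt.2)))) : ℝ) : ℂ) *
        φ.1 ⟨embIter (k + 1) lt.2, lt.1⟩).im = 0 := by
  have hsum : (∑ lt : Fin P.d × Site P (k + 1), ((Real.exp (-(r / wt Z (blockIter (k + 1) (embIter (k + 1) lt.2)))) : ℝ) : ℂ) *
      φ.1 ⟨embIter (k + 1) lt.2, lt.1⟩).im = 0 := by
    rw [Complex.im_sum]
    refine Finset.sum_eq_zero fun lt _ => ?_
    rw [Complex.mul_im, Complex.ofReal_im, Complex.ofReal_re, hφ, mul_zero, zero_mul, add_zero]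
  rw [Complex.mul_im, hsum, mul_zero, zero_add, Complex.inv_im, Complex.natCast_im, neg_zero, zero_div, zero_mul]

include hS

/-- **THE (2.38) VALUE SHAPE AT THE REAL MODEL STEP, WITH ITS COSINE FACTOR, pointwise**: `‖H(Z; g; φ)‖ ≤ A e^{−R d_{k+1}(Z)}·|cos(Σ_i g_i ω^{k+1−i})|` on the model
space `sp Z = {φ | ‖φ.1 b‖ ≤ e^{r∕w_Z(t_b)}}` for EVERY real prefix `g` (`A ≥ 0`; dag-n22-w2's `norm_readout_le_one`) — SHARPER than W1's `Bound238 … A R` (which follows by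
`|cos| ≤ 1`, exactly as dag-n22-w2's `bound238_u1Step`): the bound VANISHES at the phase zeros. [folklore] -/
theorem norm_H_le_cos_realU1 (hA : 0 ≤ A) (g : Fin (k + 1) → ℝ) (Z : (domSys P M (k + 1)).Dom) (φ : CPair P ℂ)
    (hφ : ∀ b : PBond P 0, ‖φ.1 b‖ ≤ Real.exp (r / wt Z (blockIter (k + 1) b.src))) :
    ‖S.H g φ Z‖ ≤ A * Real.exp (-(R * (domSys P M (k + 1)).dj Z)) * |Real.cos (∑ i : Fin (k + 1), g i * ω ^ (k + 1 - (i : ℕ)))| := by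
  rw [hS, norm_mul, Complex.norm_real, Real.norm_eq_abs, abs_mul, abs_of_nonneg (by positivity : 0 ≤ A * Real.exp (-(R * (domSys P M (k + 1)).dj Z)))]
  exact mul_le_of_le_one_right (by positivity) (norm_readout_le_one wt Z φ hφ)

/-- **REALITY AT REAL DATA**: the model activity is REAL at every real prefix and every configuration with real `𝐔`-component — the property the holomorphic road's `hIm`
binder asks of the (2.13) terms (§1 `E_im_eq_zero_of_real_H`). [folklore] -/
theorem H_im_eq_zero_realU1 (g : Fin (k + 1) → ℝ) (Z : (domSys P M (k + 1)).Dom) (φ : CPair P ℂ) (hφ : ∀ b : PBond P 0, (φ.1 b).im = 0) :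
    (S.H g φ Z).im = 0 := by
  rw [hS, Complex.mul_im, Complex.ofReal_im, Complex.ofReal_re, readout_im_eq_zero wt Z φ hφ, mul_zero, zero_mul, add_zero]

/-- Hence the model's (2.13) term `E^{(k+1)}(X; g; φ)` is REAL at such data. [folklore] -/
theorem E_im_eq_zero_realU1 (g : Fin (k + 1) → ℝ) (X : (domSys P M (k + 1)).Dom) (φ : CPair P ℂ) (hφ : ∀ b : PBond P 0, (φ.1 b).im = 0) :
    (S.E g φ X).im = 0 :=
  E_im_eq_zero_of_real_H S g φ (fun Z => H_im_eq_zero_realU1 S wt hS g Z φ hφ) X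

/-- **NON-DEGENERACY I — the activities READ THE CONFIGURATION**: `H(Z; g; 0) = 0` at the zero configuration, while at the zero history and the unit configuration
`𝟙 = (1, 0)` the activity has modulus `A e^{−R d(Z)}·(1∕N)Σ e^{−r∕w} > 0` (`A > 0`, a coarse pair exists) — so the localized sum genuinely depends on the probe-read
configuration (ONE statement: the two halves separately are the shapes of dag-n22-w2's `H_zero_config` ∕ `norm_H_one_config_pos` at ITS model). [folklore] -/
theorem H_reads_config_realU1 [Nonempty (Fin P.d × Site P (k + 1))] (hA : 0 < A) (g : Fin (k + 1) → ℝ) (Z : (domSys P M (k + 1)).Dom) :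
    S.H g (0 : CPair P ℂ) Z = 0 ∧ 0 < ‖S.H (fun _ => 0) ((fun _ => (1 : ℂ)), fun _ => (0 : ℂ)) Z‖ := by
  refine ⟨by rw [hS]; simp, ?_⟩
  rw [hS]
  simp only [zero_mul, Finset.sum_const_zero, Real.cos_zero, mul_one]
  rw [norm_mul, Complex.norm_real, Real.norm_eq_abs, abs_of_pos (by positivity), norm_mul, norm_inv, Complex.norm_natCast]
  refine mul_pos (by positivity) (mul_pos (inv_pos.2 (by exact_mod_cast Fintype.card_pos)) ?_)
  rw [← Complex.ofReal_sum, Complex.norm_real, Real.norm_eq_abs, abs_of_pos (Finset.sum_pos (fun _ _ => Real.exp_pos _) Finset.univ_nonempty)]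
  exact Finset.sum_pos (fun _ _ => Real.exp_pos _) Finset.univ_nonempty

/-- **NON-DEGENERACY II — the activities read the history**: freezing all couplings but `i`, `H(Z; g|g_i:=s; φ) = A e^{−R d(Z)}·cos(a_i(g) + s·ω^{k+1−i})·readout(φ)`,
`a_i(g) = Σ_j (g|g_i:=0)_j ω^{k+1−j}` — a genuine COSINE PHASE in EVERY young coupling (dag-n22-w1's `PhaseTower.sum_update_mul`). [folklore] -/
theorem H_update_realU1 (g : Fin (k + 1) → ℝ) (φ : CPair P ℂ) (Z : (domSys P M (k + 1)).Dom) (i : Fin (k + 1)) (s : ℝ) :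
    S.H (Function.update g i s) φ Z =
      ((A * Real.exp (-(R * (domSys P M (k + 1)).dj Z)) *
          Real.cos (∑ j : Fin (k + 1), Function.update g i 0 j * ω ^ (k + 1 - (j : ℕ)) + s * ω ^ (k + 1 - (i : ℕ))) : ℝ) : ℂ) *
        (((Fintype.card (Fin P.d × Site P (k + 1)) : ℂ))⁻¹ *
          ∑ lt : Fin P.d × Site P (k + 1), ((Real.exp (-(r / wt Z (blockIter (k + 1) (embIter (k + 1) lt.2)))) : ℝ) : ℂ) *
            φ.1 ⟨embIter (k + 1) lt.2, lt.1⟩) := by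
  rw [hS, sum_update_mul g (fun j : Fin (k + 1) => ω ^ (k + 1 - (j : ℕ))) i s]

/-- **THE TWO PHASE POINTS**: at `s₀ = −a_i(g)∕ω^{k+1−i}` and `s₁ = (π − a_i(g))∕ω^{k+1−i}` the frozen-coupling activities are `+A e^{−Rd}·readout(φ)` and `−A e^{−Rd}·readout(φ)`
— DIFFERENT whenever `A ≠ 0` and the read-out of `φ` is non-zero (`ω > 0`): the activity is NOT constant in any young coupling. [folklore] -/
theorem exists_update_H_ne_realU1 (hA : A ≠ 0) (hω : 0 < ω) (g : Fin (k + 1) → ℝ) (φ : CPair P ℂ) (Z : (domSys P M (k + 1)).Dom) (i : Fin (k + 1))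
    (hread : ((Fintype.card (Fin P.d × Site P (k + 1)) : ℂ))⁻¹ *
      ∑ lt : Fin P.d × Site P (k + 1), ((Real.exp (-(r / wt Z (blockIter (k + 1) (embIter (k + 1) lt.2)))) : ℝ) : ℂ) *
        φ.1 ⟨embIter (k + 1) lt.2, lt.1⟩ ≠ 0) :
    ∃ s₀ s₁ : ℝ, S.H (Function.update g i s₀) φ Z ≠ S.H (Function.update g i s₁) φ Z := by
  set a : ℝ := ∑ j : Fin (k + 1), Function.update g i 0 j * ω ^ (k + 1 - (j : ℕ)) with ha
  set c : ℝ := ω ^ (k + 1 - (i : ℕ)) with hc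
  have hc0 : c ≠ 0 := (pow_pos hω _).ne'
  refine ⟨-a / c, (Real.pi - a) / c, fun heq => ?_⟩
  rw [H_update_realU1 S wt hS, H_update_realU1 S wt hS] at heq
  have h0 : a + -a / c * c = 0 := by field_simp; ring
  have h1 : a + (Real.pi - a) / c * c = Real.pi := by field_simp; ring
  rw [← ha, ← hc, h0, h1, Real.cos_zero, Real.cos_pi] at heq
  have h2 := mul_right_cancel₀ hread heq
  have h3 : (A * Real.exp (-(R * (domSys P M (k + 1)).dj Z)) * 1 : ℝ) = A * Real.exp (-(R * (domSys P M (k + 1)).dj Z)) * (-1) := by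
    exact_mod_cast h2
  have hE : (0 : ℝ) < Real.exp (-(R * (domSys P M (k + 1)).dj Z)) := Real.exp_pos _
  have : A = 0 := by nlinarith
  exact hA this

end Step

/-! ## §3 THE JOINT (coupling, field) CHART OF THE REAL MODEL STEP: entire on `ℂ × (Fin d → Site_{k+1} → ℂ)`, bounded on `{|Im τ| < s} × ball(0, r)`, agreeing at real points —
the three activity-chart binders `hℋ ∕ hMℋ ∕ hfℋ` of `JointHoloLocalTerms.jointCharts_of_activityJointCharts` AT THE MODEL -/

section Scalar

/-- `‖cos ζ‖ ≤ e^{|Im ζ|}` (`2cos ζ = e^{iζ} + e^{−iζ}`, `‖e^{±iζ}‖ = e^{∓Im ζ}`). [folklore] -/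
theorem norm_ccos_le_exp_abs_im (ζ : ℂ) : ‖Complex.cos ζ‖ ≤ Real.exp |ζ.im| := by
  have h2 : Complex.cos ζ = (Complex.exp (ζ * Complex.I) + Complex.exp (-ζ * Complex.I)) / 2 := by
    rw [← Complex.two_cos]; ring
  have e1 : ‖Complex.exp (ζ * Complex.I)‖ ≤ Real.exp |ζ.im| := by
    rw [Complex.norm_exp, Complex.mul_I_re]; exact Real.exp_le_exp.2 (neg_le_abs _)
  have e2 : ‖Complex.exp (-ζ * Complex.I)‖ ≤ Real.exp |ζ.im| := by
    rw [Complex.norm_exp, neg_mul, Complex.neg_re, Complex.mul_I_re, neg_neg]; exact Real.exp_le_exp.2 (le_abs_self _)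
  rw [h2, norm_div, Complex.norm_two]
  calc ‖Complex.exp (ζ * Complex.I) + Complex.exp (-ζ * Complex.I)‖ / 2
      ≤ (‖Complex.exp (ζ * Complex.I)‖ + ‖Complex.exp (-ζ * Complex.I)‖) / 2 := by gcongr; exact norm_add_le _ _
    _ ≤ (Real.exp |ζ.im| + Real.exp |ζ.im|) / 2 := by gcongr
    _ = Real.exp |ζ.im| := by ring

/-- `‖cos ζ‖ ≤ e^{‖ζ‖}`. [folklore] -/
theorem norm_ccos_le_exp_norm (ζ : ℂ) : ‖Complex.cos ζ‖ ≤ Real.exp ‖ζ‖ :=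
  (norm_ccos_le_exp_abs_im ζ).trans (Real.exp_le_exp.2 (Complex.abs_im_le_norm ζ))

/-- The complex cosine read-out on a ball: `‖cos(z∕w)‖ ≤ e^{r∕w}` for `‖z‖ ≤ r`, `w > 0`. [folklore] -/
theorem norm_ccos_div_le {z : ℂ} {w r : ℝ} (hw : 0 < w) (hz : ‖z‖ ≤ r) : ‖Complex.cos (z / (w : ℂ))‖ ≤ Real.exp (r / w) := by
  refine (norm_ccos_le_exp_norm _).trans (Real.exp_le_exp.2 ?_)
  rw [norm_div, Complex.norm_real, Real.norm_eq_abs, abs_of_pos hw]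
  exact div_le_div_of_nonneg_right hz hw.le

/-- At the real point `z = B·w`: `cos((B·w)∕w) = cos B` (`w ≠ 0`), as a complex number `= ½(e^{iB} + (e^{iB})⁻¹)` with `e^{iB} = exp(ρ B)` for the chart `ρ = (x ↦ ix)`. [folklore] -/
theorem ccos_mul_div_eq_half_exp_add_inv (B w : ℝ) (hw : w ≠ 0) :
    Complex.cos (((B : ℝ) : ℂ) * (w : ℂ) / (w : ℂ)) =
      (NormedSpace.exp (((ContinuousLinearMap.id ℝ ℝ).smulRight Complex.I) B) + (NormedSpace.exp (((ContinuousLinearMap.id ℝ ℝ).smulRight Complex.I) B))⁻¹) / 2 := by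
  have hw' : (w : ℂ) ≠ 0 := Complex.ofReal_ne_zero.2 hw
  rw [mul_div_assoc, div_self hw', mul_one]
  simp only [ContinuousLinearMap.smulRight_apply, ContinuousLinearMap.id_apply, Complex.real_smul]
  rw [← congrFun Complex.exp_eq_exp_ℂ, ← Complex.exp_neg, Complex.cos, neg_mul]

/-- **THE PREFIX PHASE IS AFFINE IN ONE UPDATED COUPLING**: `Σ_{j≤k} (h|h_m:=t)_j ω^{k+1−j} = Σ_{j≤k} (h|h_m:=0)_j ω^{k+1−j} + t·c_m`, `c_m = ω^{k+1−m}` if `m ≤ k` and `0` otherwise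
(an update beyond the prefix is invisible). [folklore] -/
theorem sum_histPrefix_update (ω : ℝ) (h : ℕ → ℝ) (k m : ℕ) (t : ℝ) :
    ∑ j : Fin (k + 1), histPrefix (Function.update h m t) k j * ω ^ (k + 1 - (j : ℕ)) =
      ∑ j : Fin (k + 1), histPrefix (Function.update h m 0) k j * ω ^ (k + 1 - (j : ℕ)) + t * (if m < k + 1 then ω ^ (k + 1 - m) else 0) := by
  simp only [histPrefix_apply, Function.update_apply]
  rw [← sub_eq_iff_eq_add', ← Finset.sum_sub_distrib]
  have hterm : ∀ j : Fin (k + 1), (if (j : ℕ) = m then t else h j) * ω ^ (k + 1 - (j : ℕ)) - (if (j : ℕ) = m then 0 else h j) * ω ^ (k + 1 - (j : ℕ)) =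
      if (j : ℕ) = m then t * ω ^ (k + 1 - (j : ℕ)) else 0 := fun j => by split_ifs <;> ring
  rw [Finset.sum_congr rfl fun j _ => hterm j]
  split_ifs with hm
  · rw [Finset.sum_eq_single ⟨m, hm⟩]
    · simp
    · intro j _ hj
      rw [if_neg]
      exact fun h' => hj (Fin.ext h')
    · intro h'
      exact absurd (Finset.mem_univ _) h'
  · rw [mul_zero]
    refine Finset.sum_eq_zero fun j _ => ?_
    rw [if_neg]
    intro h'
    exact hm (h' ▸ j.isLt)

/-- The phase slope `c_m` lies in `[0, 1]` for `0 ≤ ω ≤ 1`. [folklore] -/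
theorem slope_mem_Icc {ω : ℝ} (hω0 : 0 ≤ ω) (hω1 : ω ≤ 1) (k m : ℕ) : (if m < k + 1 then ω ^ (k + 1 - m) else 0) ∈ Icc (0 : ℝ) 1 := by
  split_ifs
  · exact ⟨pow_nonneg hω0 _, pow_le_one₀ hω0 hω1⟩
  · exact ⟨le_rfl, zero_le_one⟩

end Scalar

section Chart

variable {P : Params} {M k : ℕ} (S : ClusterStep P ℂ M k) (wt : (domSys P M (k + 1)).Dom → Site P (k + 1) → ℝ) {A R ω r : ℝ}
variable (hS : ∀ (g : Fin (k + 1) → ℝ) (φ : CPair P ℂ) (Z : (domSys P M (k + 1)).Dom),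
  S.H g φ Z = ((A * Real.exp (-(R * (domSys P M (k + 1)).dj Z)) * Real.cos (∑ i : Fin (k + 1), g i * ω ^ (k + 1 - (i : ℕ))) : ℝ) : ℂ) *
    (((Fintype.card (Fin P.d × Site P (k + 1)) : ℂ))⁻¹ *
      ∑ lt : Fin P.d × Site P (k + 1), ((Real.exp (-(r / wt Z (blockIter (k + 1) (embIter (k + 1) lt.2)))) : ℝ) : ℂ) *
        φ.1 ⟨embIter (k + 1) lt.2, lt.1⟩))

/-- ★ **`hℋ` AT THE MODEL — THE JOINT CHART IS ENTIRE.**  For weights `w_X`, a polymer `Z`, a phase offset `a` and slope `c`, the joint (coupling, field) chart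
`(τ, z) ↦ A e^{−R d(Z)} · cos(a + τ c) · (1∕N) Σ_{(l,t)} e^{−r∕w_Z(t̃)} cos(z_{l,t̃}∕w_X(t̃))` is complex-differentiable on ALL of `ℂ × (Fin d → Site_{k+1} → ℂ)` — a finite sum of
products of cosines of continuous linear coordinates; it genuinely depends on BOTH variables (the sequel's `jointChart_tau_antiperiodic` ∕ `jointChart_field_zero_and_quarter`). [folklore] -/
theorem differentiable_jointChart (wX : Site P (k + 1) → ℝ) (Z : (domSys P M (k + 1)).Dom) (a c : ℝ) :
    Differentiable ℂ fun p : ℂ × (Fin P.d → Site P (k + 1) → ℂ) =>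
      ((A * Real.exp (-(R * (domSys P M (k + 1)).dj Z)) : ℝ) : ℂ) * Complex.cos ((a : ℂ) + p.1 * (c : ℂ)) *
        (((Fintype.card (Fin P.d × Site P (k + 1)) : ℂ))⁻¹ *
          ∑ lt : Fin P.d × Site P (k + 1), ((Real.exp (-(r / wt Z (blockIter (k + 1) (embIter (k + 1) lt.2)))) : ℝ) : ℂ) *
            Complex.cos (p.2 lt.1 (blockIter (k + 1) (embIter (k + 1) lt.2)) / (wX (blockIter (k + 1) (embIter (k + 1) lt.2)) : ℂ))) := by
  have hcoord : ∀ (l : Fin P.d) (t : Site P (k + 1)), Differentiable ℂ fun p : ℂ × (Fin P.d → Site P (k + 1) → ℂ) => p.2 l t := fun l t =>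
    ((differentiable_apply (𝕜 := ℂ) (F' := fun _ : Site P (k + 1) => ℂ) t).comp
      (differentiable_apply (𝕜 := ℂ) (F' := fun _ : Fin P.d => Site P (k + 1) → ℂ) l)).comp differentiable_snd
  simp only [div_eq_mul_inv]
  refine ((differentiable_const _).mul (Complex.differentiable_cos.comp ((differentiable_const _).add (differentiable_fst.mul_const _)))).mul
    ((differentiable_const _).mul (Differentiable.fun_sum fun lt _ => (differentiable_const _).mul
      (Complex.differentiable_cos.comp ((hcoord lt.1 _).mul_const _))))

/-- ★ **`hMℋ` AT THE MODEL — THE (2.38)-TYPE BOUND ON `{|Im τ| < s} × ball(0, r)`**: for `Z ⊆ X`, weights positive and MONOTONE in the domain (`w_Z ≤ w_X`: the p. 282 tail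
profile, dag-n22-w2's `tailWeight_mono`), slope `c ∈ [0, 1]`: `‖chart(τ, z)‖ ≤ A·e^{s}·e^{−R d(Z)}` — `‖cos(a + τc)‖ ≤ e^{c|Im τ|} ≤ e^{s}` and each field read-out
`e^{−r∕w_Z} cos(z∕w_X)` has norm `≤ e^{−r∕w_Z} e^{r∕w_X} ≤ 1`. [folklore] -/
theorem norm_jointChart_le (hA : 0 ≤ A) (hwt : ∀ Z t, 0 < wt Z t) (hmono : ∀ (Z X : (domSys P M (k + 1)).Dom), Z.1 ⊆ X.1 → ∀ t, wt Z t ≤ wt X t)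
    {X Z : (domSys P M (k + 1)).Dom} (hZX : Z.1 ⊆ X.1) {a c s : ℝ} (hc : c ∈ Icc (0 : ℝ) 1)
    {p : ℂ × (Fin P.d → Site P (k + 1) → ℂ)} (hp : p ∈ {τ : ℂ | |τ.im| < s} ×ˢ ball (0 : Fin P.d → Site P (k + 1) → ℂ) r) :
    ‖((A * Real.exp (-(R * (domSys P M (k + 1)).dj Z)) : ℝ) : ℂ) * Complex.cos ((a : ℂ) + p.1 * (c : ℂ)) *
        (((Fintype.card (Fin P.d × Site P (k + 1)) : ℂ))⁻¹ *
          ∑ lt : Fin P.d × Site P (k + 1), ((Real.exp (-(r / wt Z (blockIter (k + 1) (embIter (k + 1) lt.2)))) : ℝ) : ℂ) *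
            Complex.cos (p.2 lt.1 (blockIter (k + 1) (embIter (k + 1) lt.2)) / (wt X (blockIter (k + 1) (embIter (k + 1) lt.2)) : ℂ)))‖ ≤
      A * Real.exp s * Real.exp (-(R * (domSys P M (k + 1)).dj Z)) := by
  obtain ⟨hτ, hz⟩ := hp
  have hτ' : |p.1.im| < s := hτ
  have hr : 0 ≤ r := (norm_nonneg p.2).trans (mem_ball_zero_iff.1 hz).le
  -- the coupling factor
  have hcos : ‖Complex.cos ((a : ℂ) + p.1 * (c : ℂ))‖ ≤ Real.exp s := by
    refine (norm_ccos_le_exp_abs_im _).trans (Real.exp_le_exp.2 ?_)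
    have him : ((a : ℂ) + p.1 * (c : ℂ)).im = p.1.im * c := by simp
    rw [him, abs_mul, abs_of_nonneg hc.1]
    nlinarith [abs_nonneg p.1.im, hc.1, hc.2]
  -- the field factor
  have hread : ‖((Fintype.card (Fin P.d × Site P (k + 1)) : ℂ))⁻¹ *
      ∑ lt : Fin P.d × Site P (k + 1), ((Real.exp (-(r / wt Z (blockIter (k + 1) (embIter (k + 1) lt.2)))) : ℝ) : ℂ) *
        Complex.cos (p.2 lt.1 (blockIter (k + 1) (embIter (k + 1) lt.2)) / (wt X (blockIter (k + 1) (embIter (k + 1) lt.2)) : ℂ))‖ ≤ 1 := by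
    refine norm_invCard_mul_sum_le_one _ fun lt => ?_
    have hzn : ‖p.2 lt.1 (blockIter (k + 1) (embIter (k + 1) lt.2))‖ ≤ r :=
      ((norm_le_pi_norm (p.2 lt.1) _).trans (norm_le_pi_norm p.2 _)).trans (mem_ball_zero_iff.1 hz).le
    rw [norm_mul, Complex.norm_real, Real.norm_eq_abs, abs_of_pos (Real.exp_pos _)]
    calc Real.exp (-(r / wt Z (blockIter (k + 1) (embIter (k + 1) lt.2)))) * ‖Complex.cos (p.2 lt.1 (blockIter (k + 1) (embIter (k + 1) lt.2)) /
            (wt X (blockIter (k + 1) (embIter (k + 1) lt.2)) : ℂ))‖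
        ≤ Real.exp (-(r / wt Z (blockIter (k + 1) (embIter (k + 1) lt.2)))) * Real.exp (r / wt X (blockIter (k + 1) (embIter (k + 1) lt.2))) :=
          mul_le_mul_of_nonneg_left (norm_ccos_div_le (hwt X _) hzn) (Real.exp_nonneg _)
      _ ≤ 1 := by
          rw [← Real.exp_add, Real.exp_le_one_iff, neg_add_le_iff_le_add, add_zero]
          exact div_le_div_of_nonneg_left hr (hwt Z _) (hmono Z X hZX _)
  rw [norm_mul, norm_mul, Complex.norm_real, Real.norm_eq_abs, abs_of_nonneg (by positivity : 0 ≤ A * Real.exp (-(R * (domSys P M (k + 1)).dj Z)))]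
  calc A * Real.exp (-(R * (domSys P M (k + 1)).dj Z)) * ‖Complex.cos ((a : ℂ) + p.1 * (c : ℂ))‖ * _
      ≤ A * Real.exp (-(R * (domSys P M (k + 1)).dj Z)) * Real.exp s * 1 := by gcongr
    _ = A * Real.exp s * Real.exp (-(R * (domSys P M (k + 1)).dj Z)) := by ring

include hS

/-- ★ **`hfℋ` AT THE MODEL — AGREEMENT AT REAL POINTS.**  At a real coupling `t` and the complexified real probe field `ι_X B = (B_{l,s}·w_X(s))` the joint chart with offset `a` and
slope `c` takes the value `H(Z; g; emb(e^{iB}))` for EVERY prefix `g` whose phase is `Σ_j g_j ω^{k+1−j} = a + t·c`, where `emb W = (b ↦ ½(W_{b.dir}(t_b) + W_{b.dir}(t_b)⁻¹), 0)`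
is the self-adjoint part of the pulled-back probe holonomy (`cos B = ½(e^{iB} + e^{−iB})`, chart `ρ = (x ↦ ix)`; `w_X > 0`). [folklore] -/
theorem jointChart_agree (X : (domSys P M (k + 1)).Dom) (hwX : ∀ t, 0 < wt X t) (Z : (domSys P M (k + 1)).Dom) (g : Fin (k + 1) → ℝ) {a c : ℝ} (t : ℝ)
    (hg : ∑ j : Fin (k + 1), g j * ω ^ (k + 1 - (j : ℕ)) = a + t * c) (Bf : Fin P.d → Site P (k + 1) → ℝ) :
    ((A * Real.exp (-(R * (domSys P M (k + 1)).dj Z)) : ℝ) : ℂ) * Complex.cos ((a : ℂ) + (t : ℂ) * (c : ℂ)) *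
        (((Fintype.card (Fin P.d × Site P (k + 1)) : ℂ))⁻¹ *
          ∑ lt : Fin P.d × Site P (k + 1), ((Real.exp (-(r / wt Z (blockIter (k + 1) (embIter (k + 1) lt.2)))) : ℝ) : ℂ) *
            Complex.cos ((fun l s => ((Bf l s : ℝ) : ℂ) * (wt X s : ℂ)) lt.1 (blockIter (k + 1) (embIter (k + 1) lt.2)) /
              (wt X (blockIter (k + 1) (embIter (k + 1) lt.2)) : ℂ))) =
      S.H g ((fun b : PBond P 0 =>
          ((fun l s => NormedSpace.exp (((ContinuousLinearMap.id ℝ ℝ).smulRight Complex.I) (Bf l s))) b.dir (blockIter (k + 1) b.src) +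
            ((fun l s => NormedSpace.exp (((ContinuousLinearMap.id ℝ ℝ).smulRight Complex.I) (Bf l s))) b.dir (blockIter (k + 1) b.src))⁻¹) / 2),
        fun _ => (0 : ℂ)) Z := by
  rw [hS, hg]
  congr 1
  · push_cast; ring_nf
  · congr 1
    refine Finset.sum_congr rfl fun lt _ => ?_
    congr 1
    exact ccos_mul_div_eq_half_exp_add_inv _ _ (hwX _).ne'

end Chart

end YMDAG.N22.JointHoloLocalTerms.RealU1

end
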